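import Summits.CriticalPhenomena.PercolationContinuityZ3.Theorems.PercNearOneGluingNoHeavyLowerTailSahiOneStepCone
import Summits.CriticalPhenomena.PercolationContinuityZ3.Theorems.PercNearOneGluingNoHeavyLowerTailSahiE3Sections
import HarnessLib

/-!
# One-step scheme, THRESHOLD-TWO instance (`H = {at least two coordinates of F present}`), part 1/2: the block toolkit

Support file (prover prim-ineq-prove-3 gen 15; `--supports stmt-CriticalPhenomena-4575`; memo
`run/shared/lean/prim/prim-ineq-prove-3/FINDING-G14-ONESTEP-THRESHOLD.md` §4 and gen-15 addendum).  No definitions, no named facts,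
no sorries.  Part 2 (`…SahiOneStepThresholdTwo`) proves the two one-step hypotheses `m′ ≥ 0` (quantitative Harris) and `n ≥ 0` for the
first slot `H_F = {ω | ∃ i ≠ j ∈ F, i, j ∈ ω}` and concludes Kahn's Conjecture 5 / Sahi's `C₃` for that slot (THEOREM Th₂ of the memo).

This part is the bookkeeping both proofs share ("conditioning on the block `I`" done with unconditional identities):
* §1 the event `H_F`: increasing, determined by `F`; its complement = "the trace on `F` has at most one point";
* §2 for a finset `I`: the OR event `C_I = orEvent I = {ω ∩ I ≠ ∅}` (increasing, determined by `I`), its complement `Z_I`, and the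
  OUTER SECTIONS `X^ = {ω | ω ∖ I ∈ X}` (determined by `Iᶜ`; increasing if `X` is; `Z_I ∩ X = Z_I ∩ X^`); the product-measure identities
  `μ(Z_I ∩ X) = μ(Z_I)·μ(X^)`, `μ(C_I ∩ X^) = μ(C_I)·μ(X^)`, `μ(X) = μ(C_I ∩ X) + μ(Z_I ∩ X)` and two inclusion–exclusion inequalities;
* §3 the COMMON-GENERATOR SET: for up-sets `A, B` determined by `F`, not both `= univ`, and `I = {i ∈ F | {i} ∈ A ∩ B}`:
  `C_I ⊆ A ∩ B` and `A ∩ B ∖ H_F = C_I ∖ H_F` (a configuration of `A ∩ B` with at most one point in `F` has exactly one, a common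
  singleton generator).
-/

noncomputable section

namespace Summit.CriticalPhenomena.PercolationContinuityZ3.Theorems

namespace SahiOneStep

open MeasureTheory
open Literature.Probability.Percolation (DeterminedBy determinedBy_iff)
open Literature.Probability.LatticeModels (prodBernoulli sahiE3 prodBernoulli_real_inter_of_determinedBy prodBernoulli_harris
  prodBernoulli_harris_upper_lower)
open Literature.Probability.Percolation.DecisionTree (ind)
open SahiCdd (orEvent)
open scoped Classical

variable {ι : Type*} [Fintype ι]

/-! ## §1 The threshold-two event `H_F = {ω | ∃ i ∈ F, ∃ j ∈ F, i ≠ j ∧ i ∈ ω ∧ j ∈ ω}` -/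

omit [Fintype ι] in
/-- `H_F` is increasing. [this work] -/
theorem isUpperSet_thresholdTwo (F : Finset ι) :
    IsUpperSet {ω : Set ι | ∃ i ∈ F, ∃ j ∈ F, i ≠ j ∧ i ∈ ω ∧ j ∈ ω} := by
  intro ω ω' hle hω
  obtain ⟨i, hi, j, hj, hij, hiω, hjω⟩ := hω
  exact ⟨i, hi, j, hj, hij, hle hiω, hle hjω⟩

omit [Fintype ι] in
/-- `H_F` is determined by the coordinates of `F`. [this work] -/
theorem determinedBy_thresholdTwo (F : Finset ι) :
    DeterminedBy {ω : Set ι | ∃ i ∈ F, ∃ j ∈ F, i ≠ j ∧ i ∈ ω ∧ j ∈ ω} (F : Set ι) := by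
  rw [determinedBy_iff]
  intro ω ω' h
  have key : ∀ i ∈ F, (i ∈ ω ↔ i ∈ ω') := fun i hi => by
    constructor
    · intro hiω; exact ((Set.ext_iff.1 h i).1 ⟨hiω, hi⟩).1
    · intro hiω; exact ((Set.ext_iff.1 h i).2 ⟨hiω, hi⟩).1
  simp only [Set.mem_setOf_eq]
  constructor
  · rintro ⟨i, hi, j, hj, hij, hiω, hjω⟩
    exact ⟨i, hi, j, hj, hij, (key i hi).1 hiω, (key j hj).1 hjω⟩
  · rintro ⟨i, hi, j, hj, hij, hiω, hjω⟩
    exact ⟨i, hi, j, hj, hij, (key i hi).2 hiω, (key j hj).2 hjω⟩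

omit [Fintype ι] in
/-- Outside `H_F` the trace on `F` has at most one point. [this work] -/
theorem eq_of_not_mem_thresholdTwo {F : Finset ι} {ω : Set ι}
    (hω : ω ∉ {ω : Set ι | ∃ i ∈ F, ∃ j ∈ F, i ≠ j ∧ i ∈ ω ∧ j ∈ ω}) {i j : ι} (hi : i ∈ F) (hj : j ∈ F)
    (hiω : i ∈ ω) (hjω : j ∈ ω) : i = j := by
  by_contra hij
  exact hω ⟨i, hi, j, hj, hij, hiω, hjω⟩

/-! ## §2 Blocks: the OR event of a finset `I`, its complement, and outer sections -/

omit [Fintype ι] in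
/-- `C_I = orEvent I` is increasing. [folklore] -/
theorem isUpperSet_orEvent (I : Finset ι) : IsUpperSet (orEvent I : Set (Set ι)) := by
  intro ω ω' hle hω
  obtain ⟨i, hi, hiω⟩ := hω
  exact ⟨i, hi, hle hiω⟩

omit [Fintype ι] in
/-- `C_I` is determined by `I`. [folklore] -/
theorem determinedBy_orEvent (I : Finset ι) : DeterminedBy (orEvent I : Set (Set ι)) (I : Set ι) := by
  rw [determinedBy_iff]
  intro ω ω' h
  have key : ∀ i ∈ I, (i ∈ ω ↔ i ∈ ω') := fun i hi => by
    constructor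
    · intro hiω; exact ((Set.ext_iff.1 h i).1 ⟨hiω, hi⟩).1
    · intro hiω; exact ((Set.ext_iff.1 h i).2 ⟨hiω, hi⟩).1
  show (∃ i ∈ I, i ∈ ω) ↔ (∃ i ∈ I, i ∈ ω')
  exact ⟨fun ⟨i, hi, hiω⟩ => ⟨i, hi, (key i hi).1 hiω⟩, fun ⟨i, hi, hiω⟩ => ⟨i, hi, (key i hi).2 hiω⟩⟩

omit [Fintype ι] in
/-- Membership in the complement `Z_I = (orEvent I)ᶜ`: no coordinate of `I` is present. [folklore] -/
theorem not_mem_orEvent_iff (I : Finset ι) (ω : Set ι) : ω ∉ (orEvent I : Set (Set ι)) ↔ ∀ i ∈ I, i ∉ ω := by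
  simp only [orEvent, Set.mem_setOf_eq, not_exists, not_and]

omit [Fintype ι] in
/-- On `Z_I` removing `I` does nothing: `ω ∖ I = ω`. [folklore] -/
theorem sdiff_eq_self_of_not_mem_orEvent {I : Finset ι} {ω : Set ι} (hω : ω ∉ (orEvent I : Set (Set ι))) :
    ω \ (I : Set ι) = ω := by
  rw [not_mem_orEvent_iff] at hω
  ext e
  simp only [Set.mem_sdiff, Finset.mem_coe, and_iff_left_iff_imp]
  exact fun he hI => hω e hI he

omit [Fintype ι] in
/-- The outer section `X^ = {ω | ω ∖ S ∈ X}` is determined by `Sᶜ`. [folklore] -/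
theorem determinedBy_sdiff_mem (X : Set (Set ι)) (S : Set ι) : DeterminedBy {ω : Set ι | ω \ S ∈ X} Sᶜ := by
  rw [determinedBy_iff]
  intro ω ω' h
  simp only [Set.mem_setOf_eq]
  rw [Set.sdiff_eq, Set.sdiff_eq, h]

omit [Fintype ι] in
/-- The outer section of an increasing event is increasing. [folklore] -/
theorem isUpperSet_sdiff_mem {X : Set (Set ι)} (hX : IsUpperSet X) (S : Set ι) : IsUpperSet {ω : Set ι | ω \ S ∈ X} :=
  fun _ _ hle hω => hX (Set.sdiff_subset_sdiff_left hle) hω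

omit [Fintype ι] in
/-- The outer section of an increasing event is contained in it (`ω ∖ S ⊆ ω`). [folklore] -/
theorem sdiff_mem_subset {X : Set (Set ι)} (hX : IsUpperSet X) (S : Set ι) : {ω : Set ι | ω \ S ∈ X} ⊆ X :=
  fun _ hω => hX Set.sdiff_subset hω

omit [Fintype ι] in
/-- Outer sections commute with intersections. [folklore] -/
theorem sdiff_mem_inter (X Y : Set (Set ι)) (S : Set ι) :
    {ω : Set ι | ω \ S ∈ X ∩ Y} = {ω : Set ι | ω \ S ∈ X} ∩ {ω : Set ι | ω \ S ∈ Y} := by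
  ext ω; simp only [Set.mem_setOf_eq, Set.mem_inter_iff]

omit [Fintype ι] in
/-- On `Z_I` an event coincides with its outer section: `Z_I ∩ X = Z_I ∩ X^`. [folklore] -/
theorem compl_orEvent_inter_eq (I : Finset ι) (X : Set (Set ι)) :
    (orEvent I : Set (Set ι))ᶜ ∩ X = (orEvent I : Set (Set ι))ᶜ ∩ {ω : Set ι | ω \ (I : Set ι) ∈ X} := by
  ext ω
  simp only [Set.mem_inter_iff, Set.mem_compl_iff, Set.mem_setOf_eq]
  constructor
  · rintro ⟨hZ, hX⟩; exact ⟨hZ, by rwa [sdiff_eq_self_of_not_mem_orEvent hZ]⟩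
  · rintro ⟨hZ, hX⟩; exact ⟨hZ, by rwa [sdiff_eq_self_of_not_mem_orEvent hZ] at hX⟩

/-- **Factorisation across the block**: `μ(Z_I ∩ X) = μ(Z_I) · μ(X^)` (independence of `Z_I`, determined by `I`, and the outer
section, determined by `Iᶜ`). [folklore] -/
theorem real_compl_orEvent_inter (p : ι → unitInterval) (I : Finset ι) (X : Set (Set ι)) :
    (prodBernoulli p).real ((orEvent I : Set (Set ι))ᶜ ∩ X) =
      (prodBernoulli p).real (orEvent I : Set (Set ι))ᶜ * (prodBernoulli p).real {ω : Set ι | ω \ (I : Set ι) ∈ X} := by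
  rw [compl_orEvent_inter_eq]
  exact prodBernoulli_real_inter_of_determinedBy p I (Quant.determinedBy_compl_of (determinedBy_orEvent I))
    (determinedBy_sdiff_mem X _) MeasurableSet.of_discrete MeasurableSet.of_discrete

/-- `μ(C_I ∩ X^) = μ(C_I) · μ(X^)` (same independence). [folklore] -/
theorem real_orEvent_inter_sdiff_mem (p : ι → unitInterval) (I : Finset ι) (X : Set (Set ι)) :
    (prodBernoulli p).real ((orEvent I : Set (Set ι)) ∩ {ω : Set ι | ω \ (I : Set ι) ∈ X}) =
      (prodBernoulli p).real (orEvent I : Set (Set ι)) * (prodBernoulli p).real {ω : Set ι | ω \ (I : Set ι) ∈ X} :=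
  prodBernoulli_real_inter_of_determinedBy p I (determinedBy_orEvent I) (determinedBy_sdiff_mem X _)
    MeasurableSet.of_discrete MeasurableSet.of_discrete

/-- Splitting along the block: `μ(X) = μ(C_I ∩ X) + μ(Z_I ∩ X)`. [folklore] -/
theorem real_eq_orEvent_inter_add (p : ι → unitInterval) (I : Finset ι) (X : Set (Set ι)) :
    (prodBernoulli p).real X =
      (prodBernoulli p).real ((orEvent I : Set (Set ι)) ∩ X) + (prodBernoulli p).real ((orEvent I : Set (Set ι))ᶜ ∩ X) := by
  have h := measureReal_inter_add_sdiff (μ := prodBernoulli p) (s := X) (t := (orEvent I : Set (Set ι))) MeasurableSet.of_discrete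
  rw [Set.inter_comm, Set.sdiff_eq, Set.inter_comm X] at h
  exact h.symm

/-- `μ(C_I) + μ(Z_I) = 1`. [folklore] -/
theorem real_orEvent_add_compl (p : ι → unitInterval) (I : Finset ι) :
    (prodBernoulli p).real (orEvent I : Set (Set ι)) + (prodBernoulli p).real (orEvent I : Set (Set ι))ᶜ = 1 := by
  rw [measureReal_add_measureReal_compl (μ := prodBernoulli p) MeasurableSet.of_discrete, probReal_univ]

/-- `μ(X ∖ Y) = μ(X) − μ(X ∩ Y)`. [folklore] -/
theorem real_diff_eq (p : ι → unitInterval) (X Y : Set (Set ι)) :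
    (prodBernoulli p).real (X \ Y) = (prodBernoulli p).real X - (prodBernoulli p).real (X ∩ Y) := by
  have h := measureReal_inter_add_sdiff (μ := prodBernoulli p) (s := X) (t := Y) MeasurableSet.of_discrete
  linarith

/-- Inclusion–exclusion inequality inside an event: `μ(X ∩ A) + μ(X ∩ B) ≤ μ(X) + μ(X ∩ A ∩ B)`. [folklore] -/
theorem real_inter_add_inter_le (p : ι → unitInterval) (X A B : Set (Set ι)) :
    (prodBernoulli p).real (X ∩ A) + (prodBernoulli p).real (X ∩ B) ≤
      (prodBernoulli p).real X + (prodBernoulli p).real (X ∩ A ∩ B) := by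
  have hu := measureReal_union_add_inter (μ := prodBernoulli p) (s := X ∩ A) (t := X ∩ B) MeasurableSet.of_discrete
  have hi : X ∩ A ∩ (X ∩ B) = X ∩ A ∩ B := by
    ext ω; simp only [Set.mem_inter_iff]; tauto
  rw [hi] at hu
  have hle : (prodBernoulli p).real (X ∩ A ∪ X ∩ B) ≤ (prodBernoulli p).real X :=
    measureReal_mono (Set.union_subset Set.inter_subset_left Set.inter_subset_left)
  linarith

/-- `μ(Yᶜ ∩ X) = μ(X) − μ(Y ∩ X)`. [folklore] -/
theorem real_compl_inter (p : ι → unitInterval) (Y X : Set (Set ι)) :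
    (prodBernoulli p).real (Yᶜ ∩ X) = (prodBernoulli p).real X - (prodBernoulli p).real (Y ∩ X) := by
  have h := measureReal_inter_add_sdiff (μ := prodBernoulli p) (s := X) (t := Y) MeasurableSet.of_discrete
  rw [Set.sdiff_eq, Set.inter_comm X Y, Set.inter_comm X Yᶜ] at h
  linarith

/-! ## §3 The common-generator set `I = {i ∈ F | {i} ∈ A ∩ B}` -/

omit [Fintype ι] in
/-- If `{i} ∈ A ∩ B` for every `i ∈ I` and `A, B` are increasing then `C_I ⊆ A ∩ B`. [this work] -/
theorem orEvent_subset_inter {A B : Set (Set ι)} (hA : IsUpperSet A) (hB : IsUpperSet B) {I : Finset ι}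
    (hI : ∀ i ∈ I, ({i} : Set ι) ∈ A ∩ B) : (orEvent I : Set (Set ι)) ⊆ A ∩ B := by
  rintro ω ⟨i, hi, hiω⟩
  have hsub : ({i} : Set ι) ⊆ ω := Set.singleton_subset_iff.2 hiω
  exact ⟨hA hsub (hI i hi).1, hB hsub (hI i hi).2⟩

omit [Fintype ι] in
/-- **The common-generator lemma.**  Let `A, B` be increasing, determined by `F`, not both containing `∅`, and let
`I = {i ∈ F | {i} ∈ A ∩ B}`.  A configuration of `A ∩ B` outside `H_F` (at most one point of `F` present) contains a point of `I`:
`A ∩ B ∖ H_F ⊆ C_I`. [this work] -/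
theorem inter_diff_thresholdTwo_subset_orEvent {F : Finset ι} {A B : Set (Set ι)}
    (hAF : DeterminedBy A (F : Set ι)) (hBF : DeterminedBy B (F : Set ι)) (hne : (∅ : Set ι) ∉ A ∩ B) {I : Finset ι}
    (hI : ∀ i, i ∈ I ↔ i ∈ F ∧ ({i} : Set ι) ∈ A ∩ B) :
    (A ∩ B) \ {ω : Set ι | ∃ i ∈ F, ∃ j ∈ F, i ≠ j ∧ i ∈ ω ∧ j ∈ ω} ⊆ (orEvent I : Set (Set ι)) := by
  rintro ω ⟨⟨hωA, hωB⟩, hωH⟩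
  rw [determinedBy_iff] at hAF hBF
  by_cases hex : ∃ i ∈ F, i ∈ ω
  · obtain ⟨i, hi, hiω⟩ := hex
    -- the trace of `ω` on `F` is `{i}`
    have htr : ω ∩ (F : Set ι) = ({i} : Set ι) ∩ (F : Set ι) := by
      ext j
      simp only [Set.mem_inter_iff, Finset.mem_coe, Set.mem_singleton_iff]
      constructor
      · rintro ⟨hjω, hj⟩; exact ⟨(eq_of_not_mem_thresholdTwo hωH hj hi hjω hiω), hj⟩
      · rintro ⟨rfl, hj⟩; exact ⟨hiω, hj⟩
    have hiA : ({i} : Set ι) ∈ A := (hAF ω {i} htr).1 hωA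
    have hiB : ({i} : Set ι) ∈ B := (hBF ω {i} htr).1 hωB
    exact ⟨i, (hI i).2 ⟨hi, hiA, hiB⟩, hiω⟩
  · -- no point of `F` present: then `∅ ∈ A ∩ B`, excluded
    exfalso
    have htr : ω ∩ (F : Set ι) = (∅ : Set ι) ∩ (F : Set ι) := by
      rw [Set.empty_inter]
      ext j
      simp only [Set.mem_inter_iff, Finset.mem_coe, Set.mem_empty_iff_false, iff_false, not_and]
      exact fun hjω hj => hex ⟨j, hj, hjω⟩
    exact hne ⟨(hAF ω ∅ htr).1 hωA, (hBF ω ∅ htr).1 hωB⟩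

omit [Fintype ι] in
/-- With `I` as above: `A ∩ B ∖ H_F = C_I ∖ H_F`. [this work] -/
theorem inter_diff_thresholdTwo_eq {F : Finset ι} {A B : Set (Set ι)} (hA : IsUpperSet A) (hB : IsUpperSet B)
    (hAF : DeterminedBy A (F : Set ι)) (hBF : DeterminedBy B (F : Set ι)) (hne : (∅ : Set ι) ∉ A ∩ B) {I : Finset ι}
    (hI : ∀ i, i ∈ I ↔ i ∈ F ∧ ({i} : Set ι) ∈ A ∩ B) :
    (A ∩ B) \ {ω : Set ι | ∃ i ∈ F, ∃ j ∈ F, i ≠ j ∧ i ∈ ω ∧ j ∈ ω} =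
      (orEvent I : Set (Set ι)) \ {ω : Set ι | ∃ i ∈ F, ∃ j ∈ F, i ≠ j ∧ i ∈ ω ∧ j ∈ ω} := by
  apply Set.Subset.antisymm
  · exact fun ω hω => ⟨inter_diff_thresholdTwo_subset_orEvent hAF hBF hne hI hω, hω.2⟩
  · exact Set.sdiff_subset_sdiff_left (orEvent_subset_inter hA hB fun i hi => ((hI i).1 hi).2)

/-- Measure form: `μ(A ∩ B) − μ(H_F ∩ A ∩ B) = μ(C_I) − μ(C_I ∩ H_F)`. [this work] -/
theorem real_inter_sub_eq {F : Finset ι} (p : ι → unitInterval) {A B : Set (Set ι)} (hA : IsUpperSet A) (hB : IsUpperSet B)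
    (hAF : DeterminedBy A (F : Set ι)) (hBF : DeterminedBy B (F : Set ι)) (hne : (∅ : Set ι) ∉ A ∩ B) {I : Finset ι}
    (hI : ∀ i, i ∈ I ↔ i ∈ F ∧ ({i} : Set ι) ∈ A ∩ B) :
    (prodBernoulli p).real (A ∩ B) -
        (prodBernoulli p).real ({ω : Set ι | ∃ i ∈ F, ∃ j ∈ F, i ≠ j ∧ i ∈ ω ∧ j ∈ ω} ∩ A ∩ B) =
      (prodBernoulli p).real (orEvent I : Set (Set ι)) -
        (prodBernoulli p).real ((orEvent I : Set (Set ι)) ∩ {ω : Set ι | ∃ i ∈ F, ∃ j ∈ F, i ≠ j ∧ i ∈ ω ∧ j ∈ ω}) := by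
  have h1 := real_diff_eq p (A ∩ B) {ω : Set ι | ∃ i ∈ F, ∃ j ∈ F, i ≠ j ∧ i ∈ ω ∧ j ∈ ω}
  have h2 := real_diff_eq p (orEvent I : Set (Set ι)) {ω : Set ι | ∃ i ∈ F, ∃ j ∈ F, i ≠ j ∧ i ∈ ω ∧ j ∈ ω}
  rw [inter_diff_thresholdTwo_eq hA hB hAF hBF hne hI] at h1
  have h3 : {ω : Set ι | ∃ i ∈ F, ∃ j ∈ F, i ≠ j ∧ i ∈ ω ∧ j ∈ ω} ∩ A ∩ B =
      A ∩ B ∩ {ω : Set ι | ∃ i ∈ F, ∃ j ∈ F, i ≠ j ∧ i ∈ ω ∧ j ∈ ω} := by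
    ext ω; simp only [Set.mem_inter_iff]; tauto
  rw [h3]
  linarith

end SahiOneStep

end Summit.CriticalPhenomena.PercolationContinuityZ3.Theorems
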